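import Mathlib

/-!
# Pointwise `C^k` bounds for products and inverses of complex functions of a real variable
# (crux `DenseExcursion`, line `sonic-cavity-renewal`, brick for stub `stub_cavityResolventCk`, theorem T2)

Helper file (`--supports stmt-AtomisticToContinuum-12586`, line lead a2, stub-worker W4 for `stub_cavityResolventCk`).
The `C^k → C⁰` estimate of the smooth branch at the sonic point (T2) needs the size of `k` derivatives of the reduced
source `G₂ = (−a₂ τ₁ + x a₁ τ₂)/w`, `w = a₁ψ₂ − a₂ψ₁` (Wronskian of the analytic Frobenius pair), in terms of
`k` derivatives of `τ₁, τ₂` and of constants that depend on the pair only through UNIFORM bounds. This file provides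
the elementary calculus: Leibniz' rule in norm (`norm_iteratedDeriv_mul_le_of_le`: `2ⁿ C_f C_g`), sums, the embedding
`x ↦ (x : ℂ)`, and the derivatives of `1/w` bounded by a constant `C(k, m, D)` when `|w| ≥ m` and `‖w⁽ⁱ⁾‖ ≤ D`,
`i ≤ k` (registered helper `iteratedDeriv_inv_bound`; induction on `(1/w · w)⁽ⁿ⁾ = 0`). Sources: folklore.
-/

noncomputable section

open Set Filter
open scoped Topology ContDiff

namespace Summit.AtomisticToContinuum.HydrodynamicLimit.Theorems.SonicCavityRenewal

/-- LEIBNIZ IN NORM, POINTWISE: if `‖f⁽ⁱ⁾(y)‖ ≤ C_f` and `‖g⁽ⁱ⁾(y)‖ ≤ C_g` for `i ≤ n`, then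
`‖(fg)⁽ⁿ⁾(y)‖ ≤ 2ⁿ C_f C_g`. [folklore] -/
theorem norm_iteratedDeriv_mul_le_of_le {f g : ℝ → ℂ} {n : ℕ} {y : ℝ} {Cf Cg : ℝ} (hf : ContDiffAt ℝ n f y)
    (hg : ContDiffAt ℝ n g y) (hCf : 0 ≤ Cf) (hbf : ∀ i ≤ n, ‖iteratedDeriv i f y‖ ≤ Cf)
    (hbg : ∀ i ≤ n, ‖iteratedDeriv i g y‖ ≤ Cg) : ‖iteratedDeriv n (fun z => f z * g z) y‖ ≤ 2 ^ n * Cf * Cg := by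
  have hCg : 0 ≤ Cg := (norm_nonneg _).trans (hbg 0 (Nat.zero_le n))
  rw [iteratedDeriv_fun_mul hf hg]
  calc _ ≤ ∑ i ∈ Finset.range (n + 1), ‖(n.choose i : ℂ) * iteratedDeriv i f y * iteratedDeriv (n - i) g y‖ :=
        norm_sum_le _ _
    _ ≤ ∑ i ∈ Finset.range (n + 1), (n.choose i : ℝ) * (Cf * Cg) := Finset.sum_le_sum fun i hi => by
        rw [norm_mul, norm_mul, Complex.norm_natCast, mul_assoc]
        exact mul_le_mul_of_nonneg_left (mul_le_mul (hbf i (Nat.lt_succ_iff.1 (Finset.mem_range.1 hi)))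
          (hbg _ (Nat.sub_le n i)) (norm_nonneg _) hCf) (Nat.cast_nonneg _)
    _ = 2 ^ n * Cf * Cg := by
        rw [← Finset.sum_mul, ← Nat.cast_sum, Nat.sum_range_choose]; push_cast; ring

/-- The same, for all orders `j ≤ n` at once (`2ʲ ≤ 2ⁿ`). [folklore] -/
theorem norm_iteratedDeriv_mul_le_of_le' {f g : ℝ → ℂ} {n : ℕ} {y : ℝ} {Cf Cg : ℝ} (hf : ContDiffAt ℝ n f y)
    (hg : ContDiffAt ℝ n g y) (hCf : 0 ≤ Cf) (hbf : ∀ i ≤ n, ‖iteratedDeriv i f y‖ ≤ Cf)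
    (hbg : ∀ i ≤ n, ‖iteratedDeriv i g y‖ ≤ Cg) :
    ∀ j ≤ n, ‖iteratedDeriv j (fun z => f z * g z) y‖ ≤ 2 ^ n * Cf * Cg := by
  intro j hj
  have hCg : 0 ≤ Cg := (norm_nonneg _).trans (hbg 0 (Nat.zero_le n))
  have hjn : ((j : ℕ) : ℕ∞ω) ≤ n := by exact_mod_cast hj
  calc _ ≤ 2 ^ j * Cf * Cg := norm_iteratedDeriv_mul_le_of_le (hf.of_le hjn) (hg.of_le hjn) hCf
        (fun i hi => hbf i (hi.trans hj)) (fun i hi => hbg i (hi.trans hj))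
    _ ≤ 2 ^ n * Cf * Cg := by gcongr; norm_num

/-- Sums: `‖(f + g)⁽ⁿ⁾(y)‖ ≤ ‖f⁽ⁿ⁾(y)‖ + ‖g⁽ⁿ⁾(y)‖`. [folklore] -/
theorem norm_iteratedDeriv_add_le {f g : ℝ → ℂ} {n : ℕ} {y : ℝ} (hf : ContDiffAt ℝ n f y) (hg : ContDiffAt ℝ n g y) :
    ‖iteratedDeriv n (fun z => f z + g z) y‖ ≤ ‖iteratedDeriv n f y‖ + ‖iteratedDeriv n g y‖ := by
  rw [iteratedDeriv_fun_add hf hg]; exact norm_add_le _ _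

/-- The embedding `x ↦ (x : ℂ)` has all derivatives bounded by `1` on `|x| ≤ 1`. [folklore] -/
theorem norm_iteratedDeriv_ofReal_le (i : ℕ) {y : ℝ} (hy : |y| ≤ 1) : ‖iteratedDeriv i (fun z : ℝ => (z : ℂ)) y‖ ≤ 1 := by
  have hd : deriv (fun z : ℝ => (z : ℂ)) = fun _ => 1 := by
    funext z; simpa using ((hasDerivAt_id z).ofReal_comp).deriv
  rcases i with _ | _ | i
  · simpa using hy
  · rw [iteratedDeriv_one, hd]; simp
  · rw [iteratedDeriv_succ', hd, iteratedDeriv_const]; simp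

/-- `x ↦ (x : ℂ)` is smooth. [folklore] -/
theorem contDiff_ofReal' : ContDiff ℝ ∞ (fun z : ℝ => (z : ℂ)) := Complex.ofRealCLM.contDiff

/-- **Registered helper `iteratedDeriv_inv_bound`: DERIVATIVES OF AN INVERSE.** For `k`, `m > 0`, `D ≥ 0` there is
`C = C(k, m, D)` such that for every `w` of class `C^∞` on an open set of reals with `‖w‖ ≥ m` and `‖w⁽ⁱ⁾‖ ≤ D`
(`i ≤ k`) there, `‖(1/w)⁽ⁱ⁾‖ ≤ C` there (`i ≤ k`) — by induction on the Leibniz expansion of `(w · 1/w)⁽ⁿ⁾ = 0`.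
[folklore] -/
theorem iteratedDeriv_inv_bound : ∀ (k : ℕ) (m D : ℝ), 0 < m → 0 ≤ D → ∃ C : ℝ, 0 ≤ C ∧ ∀ (w : ℝ → ℂ) (s : Set ℝ), IsOpen s → ContDiffOn ℝ ∞ w s → (∀ x ∈ s, m ≤ ‖w x‖) → (∀ i : ℕ, i ≤ k → ∀ x ∈ s, ‖iteratedDeriv i w x‖ ≤ D) → ∀ i : ℕ, i ≤ k → ∀ x ∈ s, ‖iteratedDeriv i (fun y => (w y)⁻¹) x‖ ≤ C := by
  intro k m D hm hD
  induction k with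
  | zero =>
    refine ⟨m⁻¹, by positivity, fun w s _ _ hwm _ i hi x hx => ?_⟩
    rw [Nat.le_zero.1 hi, iteratedDeriv_zero, norm_inv]
    exact inv_anti₀ hm (hwm x hx)
  | succ k ih =>
    obtain ⟨C, hC0, hC⟩ := ih
    refine ⟨max C (m⁻¹ * (2 ^ (k + 1) * C * D)), le_max_of_le_left hC0, fun w s hs hw hwm hwD i hi x hx => ?_⟩
    have hC' := hC w s hs hw hwm (fun i hi => hwD i (Nat.le_succ_of_le hi))
    rcases Nat.lt_or_eq_of_le hi with hi' | rfl
    · exact (hC' i (Nat.lt_succ_iff.1 hi') x hx).trans (le_max_left _ _)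
    · refine le_trans ?_ (le_max_right C (m⁻¹ * (2 ^ (k + 1) * C * D)))
      -- the Leibniz expansion of `((1/w) · w)⁽ᵏ⁺¹⁾ = 0` at `x`
      set u : ℝ → ℂ := fun y => (w y)⁻¹ with hu
      have hwx : w x ≠ 0 := fun h => by have := hwm x hx; rw [h, norm_zero] at this; linarith
      have hwA : ContDiffAt ℝ ((k + 1 : ℕ) : ℕ∞ω) w x :=
        ((hw x hx).contDiffAt (hs.mem_nhds hx)).of_le (by exact_mod_cast le_top)
      have huA : ContDiffAt ℝ ((k + 1 : ℕ) : ℕ∞ω) u x := hwA.inv hwx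
      have hprod : iteratedDeriv (k + 1) (fun y => u y * w y) x = 0 := by
        have h1 : (fun y => u y * w y) =ᶠ[𝓝 x] fun _ => (1 : ℂ) := by
          filter_upwards [hs.mem_nhds hx] with y hy
          have hwy : w y ≠ 0 := fun h => by have := hwm y hy; rw [h, norm_zero] at this; linarith
          simp [hu, hwy]
        rw [h1.iteratedDeriv_eq, iteratedDeriv_const]; simp
      rw [iteratedDeriv_fun_mul huA hwA, Finset.sum_range_succ, Nat.choose_self, Nat.cast_one, one_mul,
        Nat.sub_self, iteratedDeriv_zero] at hprod
      -- isolate the top term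
      have hiso : iteratedDeriv (k + 1) u x =
          -(∑ i ∈ Finset.range (k + 1), ((k + 1).choose i : ℂ) * iteratedDeriv i u x * iteratedDeriv (k + 1 - i) w x) *
            (w x)⁻¹ := by
        field_simp
        linear_combination hprod
      rw [hiso, norm_mul, norm_neg, norm_inv]
      have hsum : ‖∑ i ∈ Finset.range (k + 1), ((k + 1).choose i : ℂ) * iteratedDeriv i u x * iteratedDeriv (k + 1 - i) w x‖
          ≤ 2 ^ (k + 1) * C * D := by
        calc _ ≤ ∑ i ∈ Finset.range (k + 1), ‖((k + 1).choose i : ℂ) * iteratedDeriv i u x * iteratedDeriv (k + 1 - i) w x‖ :=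
              norm_sum_le _ _
          _ ≤ ∑ i ∈ Finset.range (k + 1), ((k + 1).choose i : ℝ) * (C * D) := Finset.sum_le_sum fun i hi => by
              have hi' : i ≤ k := Nat.lt_succ_iff.1 (Finset.mem_range.1 hi)
              rw [norm_mul, norm_mul, Complex.norm_natCast, mul_assoc]
              exact mul_le_mul_of_nonneg_left (mul_le_mul (hC' i hi' x hx) (hwD _ (by omega) x hx) (norm_nonneg _) hC0)
                (Nat.cast_nonneg _)
          _ ≤ ∑ i ∈ Finset.range (k + 1 + 1), ((k + 1).choose i : ℝ) * (C * D) := by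
              conv_rhs => rw [Finset.sum_range_succ]
              exact le_add_of_nonneg_right (mul_nonneg (Nat.cast_nonneg _) (mul_nonneg hC0 hD))
          _ = 2 ^ (k + 1) * C * D := by
              rw [← Finset.sum_mul, ← Nat.cast_sum, Nat.sum_range_choose]; push_cast; ring
      calc _ ≤ 2 ^ (k + 1) * C * D * m⁻¹ :=
            mul_le_mul hsum (inv_anti₀ hm (hwm x hx)) (by positivity) (by positivity)
        _ = m⁻¹ * (2 ^ (k + 1) * C * D) := by ring

end Summit.AtomisticToContinuum.HydrodynamicLimit.Theorems.SonicCavityRenewal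

end
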